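import Summits.AtomisticToContinuum.Crystallization.Theorems.ReggeStarCoercivityDefectFreeCrystallizesRouteBetaReshape

/-!
# Route β of line `palm-good-law`, ROOT-DISCOUNT form of the core (crux `ReggeStarCoercivity.DefectFreeCrystallizes`,
# item stmt-AtomisticToContinuum-13603; lead c7, skeleton v26)

Skeleton v26 reshapes the analytic core S4 `stub_funnelRigidity` (word-uniform funnel rigidity around the ideal own-word reference with a
per-fault slack WEIGHT `w`, packing budget `W ≤ J₃ − J₂`) into the sharper ROOT-DISCOUNT form S4′ `stub_funnelRigidityRoot`: the slack is the
constant discount `W·[root cubic]` with `0 ≤ W ≤ J₃(a₁,h₁) − J₂(a₁,h₁)`.  Reason: the certificate already carries an arbitrary bounded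
finite-range transfer, which redistributes slack placed AT the cubic sites to the neighbouring sites where the first-order residual of the
ideal own-word reference lives; so the weight of S4 may be concentrated at the root, `w = W·1[‖y‖ < δ/2]`, whose packing bound is `W` on
every rooted `δ`-separated configuration.  This file is that glue (`funnelRigidity_of_funnelRigidityRoot`) and the composition
`defectFreeCrystallizes_of_funnelRigidityRoot` (S4′ → crux 9226 → the crux BY NAME, through `RouteBetaReshape`): the crux is CLOSED MODULO
{`stub_funnelRigidityRoot`, crux 9226} in the tree.  All `[folklore]` bookkeeping; no definitions.
-/

noncomputable section

open scoped ENNReal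
open Filter Topology MeasureTheory

namespace Summit.AtomisticToContinuum.Crystallization.Theorems.PalmGoodLaw.RouteBetaRootDiscount

open Summit.AtomisticToContinuum.Crystallization.Theses
open Literature.MathematicalPhysics.StatisticalMechanics Literature.Geometry.DiscreteGeometry
open Literature.Probability.Process

/-- In a rooted `δ`-separated configuration (`δ > 0`) the open ball of radius `δ/2` about the root meets the configuration only in the root
(anchor of this file). [folklore] -/
theorem ball_inter_eq_singleton_of_separated :
    ∀ δ : ℝ, 0 < δ → ∀ S : Set (EuclideanSpace ℝ (Fin 3)), (0 : EuclideanSpace ℝ (Fin 3)) ∈ S →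
      (∀ x ∈ S, ∀ y ∈ S, x ≠ y → δ ≤ dist x y) →
      Metric.ball (0 : EuclideanSpace ℝ (Fin 3)) (δ / 2) ∩ S = {0} := by
  intro δ hδ S h0 hsep
  ext y
  simp only [Set.mem_inter_iff, Metric.mem_ball, Set.mem_singleton_iff]
  constructor
  · rintro ⟨hy, hyS⟩
    by_contra hne
    have h1 := hsep y hyS 0 h0 hne
    linarith
  · rintro rfl
    exact ⟨by rw [dist_self]; positivity, h0⟩

/-- **Root-discount funnel rigidity (S4′) ⇒ funnel rigidity with per-fault slack (S4)**.  Hypothesis `hS4r` is VERBATIM the registered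
stub `stub_funnelRigidityRoot` of skeleton v26 (the discount `W·[root cubic]`, `0 ≤ W ≤ J₃ − J₂`); the conclusion is VERBATIM the hypothesis
`hS4` of `funnelCertificates_of_funnelRigidity` (skeleton v24's `stub_funnelRigidity`).  Proof: take the root-concentrated weight
`w = W·1[‖y‖ < δ/2]` — even, measurable, with packing bound exactly `W` on every rooted `δ`-separated configuration (the ball meets `S` only in
the root), and `Σ_{cubic y ∈ S} w(y) = W·[root cubic]`. [folklore] -/
theorem funnelRigidity_of_funnelRigidityRoot :
    (∀ a₁ h₁ : ℝ, 47 / 50 ≤ a₁ → a₁ ≤ 1 → 39 / 50 * a₁ ≤ h₁ → h₁ ≤ 17 / 20 * a₁ →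
      (∀ a h : ℝ, 0 < a → 0 < h →
        Summit.AtomisticToContinuum.Crystallization.Theorems.PalmUnimodularRigidity.LayeredLawsSelectHcp.hcpE a₁ h₁ ≤
          Summit.AtomisticToContinuum.Crystallization.Theorems.PalmUnimodularRigidity.LayeredLawsSelectHcp.hcpE a h) →
      ∃ κ : ℝ, 0 < κ ∧ ∃ W : ℝ, 0 ≤ W ∧ W ≤ barlowCoupling lennardJones a₁ h₁ 3 - barlowCoupling lennardJones a₁ h₁ 2 ∧
        ∀ δ : ℝ, 0 < δ → ∀ ε : ℝ, 0 < ε →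
            ∃ R M : ℝ, ∃ t : Measure (EuclideanSpace ℝ (Fin 3)) → EuclideanSpace ℝ (Fin 3) → ℝ,
              (Measurable (Function.uncurry t) ∧ (∀ μ y, |t μ y| ≤ M) ∧ ∀ μ y, R < ‖y‖ → t μ y = 0) ∧
              ∀ (μ : Measure (EuclideanSpace ℝ (Fin 3))) (S : Set (EuclideanSpace ℝ (Fin 3))) (s : ℤ → ℤ)
                (Φ : EuclideanSpace ℝ (Fin 3) → EuclideanSpace ℝ (Fin 3)),
                μ = (Measure.count : Measure (EuclideanSpace ℝ (Fin 3))).restrict S →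
                (0 : EuclideanSpace ℝ (Fin 3)) ∈ S → (∀ x ∈ S, ∀ y ∈ S, x ≠ y → δ ≤ dist x y) →
                (∀ y ∈ S, SetGood S y) → IsHaggSeq s →
                Set.BijOn Φ (barlowStacking 1 (Real.sqrt (2 / 3)) s) S →
                (∀ p ∈ barlowStacking 1 (Real.sqrt (2 / 3)) s, ∀ q ∈ barlowStacking 1 (Real.sqrt (2 / 3)) s,
                  (dist p q = 1 ↔ (0 < dist (Φ p) (Φ q) ∧ dist (Φ p) (Φ q) < 6 / 5))) →
                (∀ p ∈ S, HasSum (fun q : {q : EuclideanSpace ℝ (Fin 3) // q ∈ S ∧ q ≠ p} =>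
                  (deriv lennardJones (dist p q.1) / dist p q.1) • (p - q.1)) 0) →
                ∀ k i j : ℤ, Φ (barlowPos 1 (Real.sqrt (2 / 3)) s k i j) = 0 →
                  (barlowSiteEnergy lennardJones a₁ h₁ s k - ε -
                        {S' : Set (EuclideanSpace ℝ (Fin 3)) | FunnelSites.IsCubicSite65 S' 0}.indicator (fun _ => W) S ≤
                      (∫ y, lennardJones ‖y‖ ∂μ) / 2 + ∫ y, (t μ y - t (Measure.map (fun z => z - y) μ) (-y)) ∂μ) ∧
                  ((¬ ∃ a : ℝ, 9 / 10 ≤ a ∧ a ≤ 1 ∧ ∃ T : Finset (EuclideanSpace ℝ (Fin 3)),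
                      (↑T : Set (EuclideanSpace ℝ (Fin 3))) =
                        {y : EuclideanSpace ℝ (Fin 3) | μ {y} ≠ 0 ∧ y ≠ 0 ∧ ‖y‖ ≤ 5 / 4 * a} ∧
                      (ShellCloseTo (a / 100) T (Finset.image (fun v : EuclideanSpace ℝ (Fin 3) => a • v) fccKissingPattern) ∨
                        ShellCloseTo (a / 100) T
                          (Finset.image (fun v : EuclideanSpace ℝ (Fin 3) => a • v) hcpKissingPattern))) →
                    barlowSiteEnergy lennardJones a₁ h₁ s k - ε -
                          {S' : Set (EuclideanSpace ℝ (Fin 3)) | FunnelSites.IsCubicSite65 S' 0}.indicator (fun _ => W) S + κ ≤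
                      (∫ y, lennardJones ‖y‖ ∂μ) / 2 + ∫ y, (t μ y - t (Measure.map (fun z => z - y) μ) (-y)) ∂μ)) →
    ∀ a₁ h₁ : ℝ, 47 / 50 ≤ a₁ → a₁ ≤ 1 → 39 / 50 * a₁ ≤ h₁ → h₁ ≤ 17 / 20 * a₁ →
      (∀ a h : ℝ, 0 < a → 0 < h →
        Summit.AtomisticToContinuum.Crystallization.Theorems.PalmUnimodularRigidity.LayeredLawsSelectHcp.hcpE a₁ h₁ ≤
          Summit.AtomisticToContinuum.Crystallization.Theorems.PalmUnimodularRigidity.LayeredLawsSelectHcp.hcpE a h) →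
      ∃ κ : ℝ, 0 < κ ∧ ∀ δ : ℝ, 0 < δ →
        ∃ (w : EuclideanSpace ℝ (Fin 3) → ℝ≥0∞) (W : ℝ),
          Measurable w ∧ (∀ y, w (-y) = w y) ∧ 0 ≤ W ∧
          (∀ μ : Measure (EuclideanSpace ℝ (Fin 3)), IsRootedHardCore δ μ → ∫⁻ y, w y ∂μ ≤ ENNReal.ofReal W) ∧
          W ≤ barlowCoupling lennardJones a₁ h₁ 3 - barlowCoupling lennardJones a₁ h₁ 2 ∧
          ∀ ε : ℝ, 0 < ε →
            ∃ R M : ℝ, ∃ t : Measure (EuclideanSpace ℝ (Fin 3)) → EuclideanSpace ℝ (Fin 3) → ℝ,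
              (Measurable (Function.uncurry t) ∧ (∀ μ y, |t μ y| ≤ M) ∧ ∀ μ y, R < ‖y‖ → t μ y = 0) ∧
              ∀ (μ : Measure (EuclideanSpace ℝ (Fin 3))) (S : Set (EuclideanSpace ℝ (Fin 3))) (s : ℤ → ℤ)
                (Φ : EuclideanSpace ℝ (Fin 3) → EuclideanSpace ℝ (Fin 3)),
                μ = (Measure.count : Measure (EuclideanSpace ℝ (Fin 3))).restrict S →
                (0 : EuclideanSpace ℝ (Fin 3)) ∈ S → (∀ x ∈ S, ∀ y ∈ S, x ≠ y → δ ≤ dist x y) →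
                (∀ y ∈ S, SetGood S y) → IsHaggSeq s →
                Set.BijOn Φ (barlowStacking 1 (Real.sqrt (2 / 3)) s) S →
                (∀ p ∈ barlowStacking 1 (Real.sqrt (2 / 3)) s, ∀ q ∈ barlowStacking 1 (Real.sqrt (2 / 3)) s,
                  (dist p q = 1 ↔ (0 < dist (Φ p) (Φ q) ∧ dist (Φ p) (Φ q) < 6 / 5))) →
                (∀ p ∈ S, HasSum (fun q : {q : EuclideanSpace ℝ (Fin 3) // q ∈ S ∧ q ≠ p} =>
                  (deriv lennardJones (dist p q.1) / dist p q.1) • (p - q.1)) 0) →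
                ∀ k i j : ℤ, Φ (barlowPos 1 (Real.sqrt (2 / 3)) s k i j) = 0 →
                  (barlowSiteEnergy lennardJones a₁ h₁ s k - ε -
                        (∫⁻ y, {y : EuclideanSpace ℝ (Fin 3) | FunnelSites.IsCubicSite65 S y}.indicator w y ∂μ).toReal ≤
                      (∫ y, lennardJones ‖y‖ ∂μ) / 2 + ∫ y, (t μ y - t (Measure.map (fun z => z - y) μ) (-y)) ∂μ) ∧
                  ((¬ ∃ a : ℝ, 9 / 10 ≤ a ∧ a ≤ 1 ∧ ∃ T : Finset (EuclideanSpace ℝ (Fin 3)),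
                      (↑T : Set (EuclideanSpace ℝ (Fin 3))) =
                        {y : EuclideanSpace ℝ (Fin 3) | μ {y} ≠ 0 ∧ y ≠ 0 ∧ ‖y‖ ≤ 5 / 4 * a} ∧
                      (ShellCloseTo (a / 100) T (Finset.image (fun v : EuclideanSpace ℝ (Fin 3) => a • v) fccKissingPattern) ∨
                        ShellCloseTo (a / 100) T
                          (Finset.image (fun v : EuclideanSpace ℝ (Fin 3) => a • v) hcpKissingPattern))) →
                    barlowSiteEnergy lennardJones a₁ h₁ s k - ε -
                          (∫⁻ y, {y : EuclideanSpace ℝ (Fin 3) | FunnelSites.IsCubicSite65 S y}.indicator w y ∂μ).toReal + κ ≤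
                      (∫ y, lennardJones ‖y‖ ∂μ) / 2 + ∫ y, (t μ y - t (Measure.map (fun z => z - y) μ) (-y)) ∂μ) := by
  classical
  intro hS4r a₁ h₁ hb1 hb2 hr₁ hr₂ hmin
  obtain ⟨κ, hκ, W, hW0, hWJ, hroot⟩ := hS4r a₁ h₁ hb1 hb2 hr₁ hr₂ hmin
  refine ⟨κ, hκ, fun δ hδ => ?_⟩
  -- the root-concentrated weight `W · 1[‖y‖ < δ/2]`
  set w : EuclideanSpace ℝ (Fin 3) → ℝ≥0∞ :=
    (Metric.ball (0 : EuclideanSpace ℝ (Fin 3)) (δ / 2)).indicator (fun _ => ENNReal.ofReal W) with hw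
  have hwm : Measurable w := measurable_const.indicator measurableSet_ball
  have hweven : ∀ y, w (-y) = w y := by
    intro y
    have hmem : (-y ∈ Metric.ball (0 : EuclideanSpace ℝ (Fin 3)) (δ / 2)) ↔
        (y ∈ Metric.ball (0 : EuclideanSpace ℝ (Fin 3)) (δ / 2)) := by
      simp only [Metric.mem_ball, dist_zero_right, norm_neg]
    by_cases hy : y ∈ Metric.ball (0 : EuclideanSpace ℝ (Fin 3)) (δ / 2)
    · rw [hw, Set.indicator_of_mem hy, Set.indicator_of_mem (hmem.2 hy)]
    · rw [hw, Set.indicator_of_notMem hy, Set.indicator_of_notMem (fun h => hy (hmem.1 h))]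
  -- on a rooted `δ`-separated `S` the small ball around the root contains only the root
  have hball : ∀ S : Set (EuclideanSpace ℝ (Fin 3)), (0 : EuclideanSpace ℝ (Fin 3)) ∈ S →
      (∀ x ∈ S, ∀ y ∈ S, x ≠ y → δ ≤ dist x y) →
      Metric.ball (0 : EuclideanSpace ℝ (Fin 3)) (δ / 2) ∩ S = {0} :=
    ball_inter_eq_singleton_of_separated δ hδ
  have hpack : ∀ μ : Measure (EuclideanSpace ℝ (Fin 3)), IsRootedHardCore δ μ → ∫⁻ y, w y ∂μ ≤ ENNReal.ofReal W := by
    intro μ hμ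
    obtain ⟨S, h0, hsep, rfl⟩ := hμ
    rw [hw, lintegral_indicator_const measurableSet_ball, Measure.restrict_apply measurableSet_ball, hball S h0 hsep,
      Measure.count_singleton, mul_one]
  refine ⟨w, W, hwm, hweven, hW0, hpack, hWJ, fun ε hε => ?_⟩
  obtain ⟨R, M, t, ht, hpt⟩ := hroot δ hδ ε hε
  refine ⟨R, M, t, ht, ?_⟩
  intro μ S s Φ hμS h0 hsep hgood hs hbij hiso hFB k i j hk
  have key := hpt μ S s Φ hμS h0 hsep hgood hs hbij hiso hFB k i j hk
  -- the cubic sites in the small ball around the root: the root itself, if it is cubic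
  have hset : {y : EuclideanSpace ℝ (Fin 3) | FunnelSites.IsCubicSite65 S y} ∩
      Metric.ball (0 : EuclideanSpace ℝ (Fin 3)) (δ / 2) =
      (if FunnelSites.IsCubicSite65 S 0 then ({0} : Set (EuclideanSpace ℝ (Fin 3))) else ∅) := by
    ext y
    simp only [Set.mem_inter_iff, Set.mem_setOf_eq]
    constructor
    · rintro ⟨hc, hb⟩
      have hy0 : y = 0 := by
        have : y ∈ Metric.ball (0 : EuclideanSpace ℝ (Fin 3)) (δ / 2) ∩ S := ⟨hb, hc.1⟩
        rwa [hball S h0 hsep] at this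
      subst hy0
      rw [if_pos hc]
      exact Set.mem_singleton 0
    · intro hy
      split_ifs at hy with hc
      · rw [Set.mem_singleton_iff] at hy
        subst hy
        exact ⟨hc, Metric.mem_ball_self (by positivity)⟩
      · exact absurd hy (Set.notMem_empty y)
  -- the slack term of S4 is the root indicator
  have hslack : (∫⁻ y, {y : EuclideanSpace ℝ (Fin 3) | FunnelSites.IsCubicSite65 S y}.indicator w y ∂μ).toReal =
      {S' : Set (EuclideanSpace ℝ (Fin 3)) | FunnelSites.IsCubicSite65 S' 0}.indicator (fun _ => W) S := by
    have hind : ∀ y, {y : EuclideanSpace ℝ (Fin 3) | FunnelSites.IsCubicSite65 S y}.indicator w y =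
        (if FunnelSites.IsCubicSite65 S 0 then ({0} : Set (EuclideanSpace ℝ (Fin 3))) else ∅).indicator
          (fun _ => ENNReal.ofReal W) y := by
      intro y
      rw [hw, Set.indicator_indicator, hset]
    simp_rw [hind]
    by_cases hc : FunnelSites.IsCubicSite65 S 0
    · have hm : S ∈ {S' : Set (EuclideanSpace ℝ (Fin 3)) | FunnelSites.IsCubicSite65 S' 0} := hc
      rw [if_pos hc, Set.indicator_of_mem hm, lintegral_indicator_const (measurableSet_singleton 0), hμS,
        Measure.restrict_apply (measurableSet_singleton 0),
        Set.inter_eq_left.2 (Set.singleton_subset_iff.2 h0), Measure.count_singleton, mul_one,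
        ENNReal.toReal_ofReal hW0]
    · have hm : S ∉ {S' : Set (EuclideanSpace ℝ (Fin 3)) | FunnelSites.IsCubicSite65 S' 0} := hc
      rw [if_neg hc, Set.indicator_of_notMem hm]
      simp only [Set.indicator_empty, lintegral_const, zero_mul, ENNReal.toReal_zero]
  rw [hslack]
  exact key

/-- **The crux from root-discount funnel rigidity (S4′) and crux 9226 (sorry-free)**: the crux is CLOSED MODULO
{`stub_funnelRigidityRoot`, crux 9226} in the tree.  Glue-by candidate for a split of the crux into {FunnelRigidityRoot, LayeredLawsSelectHcp}.
[folklore] -/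
theorem defectFreeCrystallizes_of_funnelRigidityRoot
    (hS4r : ∀ a₁ h₁ : ℝ, 47 / 50 ≤ a₁ → a₁ ≤ 1 → 39 / 50 * a₁ ≤ h₁ → h₁ ≤ 17 / 20 * a₁ →
      (∀ a h : ℝ, 0 < a → 0 < h →
        Summit.AtomisticToContinuum.Crystallization.Theorems.PalmUnimodularRigidity.LayeredLawsSelectHcp.hcpE a₁ h₁ ≤
          Summit.AtomisticToContinuum.Crystallization.Theorems.PalmUnimodularRigidity.LayeredLawsSelectHcp.hcpE a h) →
      ∃ κ : ℝ, 0 < κ ∧ ∃ W : ℝ, 0 ≤ W ∧ W ≤ barlowCoupling lennardJones a₁ h₁ 3 - barlowCoupling lennardJones a₁ h₁ 2 ∧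
        ∀ δ : ℝ, 0 < δ → ∀ ε : ℝ, 0 < ε →
            ∃ R M : ℝ, ∃ t : Measure (EuclideanSpace ℝ (Fin 3)) → EuclideanSpace ℝ (Fin 3) → ℝ,
              (Measurable (Function.uncurry t) ∧ (∀ μ y, |t μ y| ≤ M) ∧ ∀ μ y, R < ‖y‖ → t μ y = 0) ∧
              ∀ (μ : Measure (EuclideanSpace ℝ (Fin 3))) (S : Set (EuclideanSpace ℝ (Fin 3))) (s : ℤ → ℤ)
                (Φ : EuclideanSpace ℝ (Fin 3) → EuclideanSpace ℝ (Fin 3)),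
                μ = (Measure.count : Measure (EuclideanSpace ℝ (Fin 3))).restrict S →
                (0 : EuclideanSpace ℝ (Fin 3)) ∈ S → (∀ x ∈ S, ∀ y ∈ S, x ≠ y → δ ≤ dist x y) →
                (∀ y ∈ S, SetGood S y) → IsHaggSeq s →
                Set.BijOn Φ (barlowStacking 1 (Real.sqrt (2 / 3)) s) S →
                (∀ p ∈ barlowStacking 1 (Real.sqrt (2 / 3)) s, ∀ q ∈ barlowStacking 1 (Real.sqrt (2 / 3)) s,
                  (dist p q = 1 ↔ (0 < dist (Φ p) (Φ q) ∧ dist (Φ p) (Φ q) < 6 / 5))) →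
                (∀ p ∈ S, HasSum (fun q : {q : EuclideanSpace ℝ (Fin 3) // q ∈ S ∧ q ≠ p} =>
                  (deriv lennardJones (dist p q.1) / dist p q.1) • (p - q.1)) 0) →
                ∀ k i j : ℤ, Φ (barlowPos 1 (Real.sqrt (2 / 3)) s k i j) = 0 →
                  (barlowSiteEnergy lennardJones a₁ h₁ s k - ε -
                        {S' : Set (EuclideanSpace ℝ (Fin 3)) | FunnelSites.IsCubicSite65 S' 0}.indicator (fun _ => W) S ≤
                      (∫ y, lennardJones ‖y‖ ∂μ) / 2 + ∫ y, (t μ y - t (Measure.map (fun z => z - y) μ) (-y)) ∂μ) ∧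
                  ((¬ ∃ a : ℝ, 9 / 10 ≤ a ∧ a ≤ 1 ∧ ∃ T : Finset (EuclideanSpace ℝ (Fin 3)),
                      (↑T : Set (EuclideanSpace ℝ (Fin 3))) =
                        {y : EuclideanSpace ℝ (Fin 3) | μ {y} ≠ 0 ∧ y ≠ 0 ∧ ‖y‖ ≤ 5 / 4 * a} ∧
                      (ShellCloseTo (a / 100) T (Finset.image (fun v : EuclideanSpace ℝ (Fin 3) => a • v) fccKissingPattern) ∨
                        ShellCloseTo (a / 100) T
                          (Finset.image (fun v : EuclideanSpace ℝ (Fin 3) => a • v) hcpKissingPattern))) →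
                    barlowSiteEnergy lennardJones a₁ h₁ s k - ε -
                          {S' : Set (EuclideanSpace ℝ (Fin 3)) | FunnelSites.IsCubicSite65 S' 0}.indicator (fun _ => W) S + κ ≤
                      (∫ y, lennardJones ‖y‖ ∂μ) / 2 + ∫ y, (t μ y - t (Measure.map (fun z => z - y) μ) (-y)) ∂μ))
    (h9226 : PalmUnimodularRigidity.LayeredLawsSelectHcp) :
    Summit.AtomisticToContinuum.Crystallization.Theses.ReggeStarCoercivity.DefectFreeCrystallizes :=
  RouteBetaReshape.defectFreeCrystallizes_of_funnelRigidity (funnelRigidity_of_funnelRigidityRoot hS4r) h9226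

end Summit.AtomisticToContinuum.Crystallization.Theorems.PalmGoodLaw.RouteBetaRootDiscount

end
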